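import Literature.MathematicalPhysics.QuantumLattice.HubbardTTPrimeGrandCanonicalThermalStatesKMSRows
import Literature.MathematicalPhysics.QuantumLattice.GibbsKMSMomentRow
import Literature.MathematicalPhysics.QuantumLattice.FermionGroundStatesMinimiseMeanEnergy
import HarnessLib

/-!
# Thermal grand-canonical states of the 2D `t–t'` Hubbard model satisfy the KMS-moment rows for EVERY local word

Family `hubbard` (topic `MathematicalPhysics/QuantumLattice`). The KMS-moment twin of
`HubbardTTPrimeGrandCanonicalThermalStatesKMSRows` / `…BogoliubovRows` and the grand-canonical companion of
`InfVolFermionStateTorusLimitKMSMomentRow` (the same rows for CANONICAL torus limits, gauge-invariant words only). For a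
torus limit `ω` of the grand-canonical Gibbs states of `K_L(t,t',U,μ,h) = H_L − μN − hM` (eigen-mixtures
`(sourcedGibbsCount, gcGibbsWeightTT' β …, gcGibbsVectorTT' …)`) at any real `β`, every region `Λ`, every window
`Λ' ⊇ Λ` with `((·)₁)^K Λ ⊆ Λ'`, EVERY `A ∈ 𝔄_Λ` (charged words included; `Ã = Γ_{Λ⊆Λ'}A`,
`K_{Λ'} = gcLocalHamiltonianTT' Λ' t t' U μ h`), and all `p q : ℕ → ℝ` with `Σ_{k≤K}(pₖ + qₖe^{-βx})x^k ≥ 0` on `ℝ`: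

  `0 ≤ Σ_{k≤K} ( pₖ Re ω_{Λ'}(Ãᴴ ad_{K_{Λ'}}^k Ã) + qₖ Re ω_{Λ'}((ad_{K_{Λ'}}^k Ã)Ãᴴ) )`

(`IsTorusLimitOfMixture.sum_range_kmsMoment_nonneg_of_gcGibbs`) — positivity of the exponential polynomial against the
spectral measure of `Ã` in a `β`-KMS state of the GRAND-CANONICAL dynamics (Itoi–Ishimori–Sato–Sakamoto §3); read over
a template family an exact KMS constraint LINEAR in the moments of `ω` (row family `kmsmom`), now for the full word algebra.
Ingredients: §1 the charges of a window split along a subregion (`spinNumber_eq_fermionEmbed_add_sum`,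
`commute_outsideSpinNumber_fermionEmbed`) and SUPPORT GROWTH `K_{Λ'}ΓB − ΓB K_{Λ'} = Γ_{Λ₁⊆Λ'}(K_{Λ₁}ΓB − ΓB K_{Λ₁})`,
`Λ₁ = thicken Λ 1` (`gcLocalHamiltonianTT'_commutator_fermionEmbed_eq`; `spinNumber_/spinImbalance_commutator_fermionEmbed_eq`);
§2 ITERATED LOCALITY `Γ(ad_{K_{Λ'}}^k Ã) = ad_{K_L}^k (ΓÃ)` for `((·)₁)^k Λ ⊆ Λ'`
(`fermionEmbed_toTorusEmb_adPow_gcLocalHamiltonianTT'`); §3 the finite-volume rows for EVERY torus word in the translated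
grand-canonical eigen-mixtures (`sum_range_kmsMoment_gcGibbs_fockTranslate_nonneg`: the generic sector lemma
`sum_range_kmsMoment_sectorMixture_mulVec_nonneg` on the trivial sector); §4 the translation average; §5 the limit.
Everything is PROVED; no definition, no named fact, no sorry. WHAT THIS IS NOT: the converse; a number.

## Mathlib / tree search

`lean search 'kmsMoment.*gc|adPow.*gcLocal'`: nothing (2026-08-27). REUSED: `Matrix.adPow`, `adPow_succ`
(`SpectralCorrelationInequalities`), `sum_range_kmsMoment_sectorMixture_mulVec_nonneg` (`GibbsKMSMomentRow`),
`hubbardTTPrime_localHamiltonian_commutator_fermionEmbed_eq`, `totalNumber_commutator_fermionEmbed_eq`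
(`HubbardTTPrimeWindowCertificateAbstractState`), `mem_lexSites`, `disjoint_orbs`, `commute_fermionEmbed_of_mem_carEvenSubalgebra`,
`numberOp_mem_carEvenSubalgebra`, `fermionEmbed_numberOp`; `gcTorusHamiltonianTT'_commutator_fermionEmbed`,
`fockTranslate_commute_gcTorusHamiltonianTT'`, `gcLocalHamiltonianTT'`, `spinImbalance_eq_spinNumber_sub_spinNumber`
(`HubbardTTPrimeGrandCanonicalThermalStatesKMSRows`); `gcGibbs*TT'`, `canonicalWeight_comp_equiv'`, `torusAvgExpectAt_of_injOn`,
`torusAvgExpect_eq`, `eventually_injOn_proj_of_tendsto`. The monotonicity of iterated neighbourhoods and `ad^{k+1} = ad^k ∘ ad`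
are re-proved privately (as in the canonical file).

## References

* C. Itoi, H. Ishimori, K. Sato, Y. Sakamoto, J. Phys. Soc. Jpn. 92 (2023) 074001 = arXiv:2306.03489, §3 Lemmas 1–5 and
  Thms 1–4 (spectral representation of `β`-KMS correlation inequalities). [cite: ItoiEtAl2023, §3]
* H. Fawzi, O. Fawzi, S. O. Scalet, Nat. Commun. 15 (2024) 7394, Thm 3.1. [cite: FawziFawziScalet2024, Thm 3.1]
* O. Bratteli, D. W. Robinson, *Operator Algebras and Quantum Statistical Mechanics II* (1997), Thm. 6.2.4 and its proof
  (iterated commutators with local Hamiltonians), §6.2.1, §5.2.2. [cite: BratteliRobinsonII1997, Thm. 6.2.4]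
-/

noncomputable section

namespace Literature.MathematicalPhysics.QuantumLattice

open Matrix Finset HubbardWave0 Literature.Probability.LatticeModels ThermodynamicLimit LiebThm1
open _root_.Filter
open scoped _root_.Topology ComplexOrder BigOperators

/-! ### §1 Region level: the charges of a window split along a subregion; support growth of `[K_{Λ'}, ΓB]` -/

section Region

variable {d : ℕ} {Λ Λ' : Finset (Site d)}

/-- **The spin-`σ` number of `Λ' ⊇ Λ` splits along `Λ`**: `N_{σ,Λ'} = Γ(N_{σ,Λ}) + Σ_{x ∈ Λ'∖Λ} n_{xσ}`.
[cite: BratteliRobinsonII1997, §6.2.1] -/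
theorem spinNumber_eq_fermionEmbed_add_sum (hΛ : Λ ⊆ Λ') (σ : Fin 2) :
    (∑ p : PolySite Λ', numberOp p σ : FermionOp Λ') =
      fermionEmbed (PolySite.incl hΛ) (∑ p : PolySite Λ, numberOp p σ) +
        ∑ p ∈ (Finset.univ : Finset (PolySite Λ')) with ofLex p.1 ∉ Λ, numberOp p σ := by
  classical
  have hmap : (Finset.univ : Finset (PolySite Λ')).filter (fun p => ofLex p.1 ∈ Λ) =
      (Finset.univ : Finset (PolySite Λ)).map (PolySite.incl hΛ) := by
    ext p
    simp only [Finset.mem_filter, Finset.mem_univ, true_and, Finset.mem_map]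
    constructor
    · intro hp
      exact ⟨⟨p.1, mem_lexSites.2 hp⟩, Subtype.ext rfl⟩
    · rintro ⟨q, rfl⟩
      exact mem_lexSites.1 q.2
  rw [← Finset.sum_filter_add_sum_filter_not Finset.univ (fun p : PolySite Λ' => ofLex p.1 ∈ Λ), hmap,
    Finset.sum_map, map_sum]
  congr 1
  exact Finset.sum_congr rfl fun q _ => (fermionEmbed_numberOp _ q σ).symm

/-- The spin-`σ` number outside `Λ` commutes with every observable of `Λ`. [cite: BratteliRobinsonII1997, §5.2.2] -/
theorem commute_outsideSpinNumber_fermionEmbed (hΛ : Λ ⊆ Λ') (σ : Fin 2) (A : FermionOp Λ) :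
    Commute (∑ p ∈ (Finset.univ : Finset (PolySite Λ')) with ofLex p.1 ∉ Λ, numberOp p σ)
      (fermionEmbed (PolySite.incl hΛ) A) := by
  refine Commute.sum_left _ _ _ fun p hp => ?_
  rw [Finset.mem_filter] at hp
  refine commute_fermionEmbed_of_mem_carEvenSubalgebra (PolySite.incl hΛ) A
    (numberOp_mem_carEvenSubalgebra (orb_mem_orbs.2 (Finset.mem_singleton_self p))) ?_
  refine disjoint_orbs (Finset.disjoint_singleton_left.2 fun h => hp.2 ?_)
  rw [Finset.mem_map] at h
  obtain ⟨q, -, rfl⟩ := h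
  exact mem_lexSites.1 q.2

/-- **Support growth for the spin numbers**: `N_{σ,Λ'} Γ_{Λ⊆Λ'}B − Γ_{Λ⊆Λ'}B N_{σ,Λ'} = Γ_{Λ₁⊆Λ'}(N_{σ,Λ₁} ΓB − ΓB N_{σ,Λ₁})`
for `Λ ⊆ Λ₁ ⊆ Λ'`. [cite: BratteliRobinsonII1997, §6.2.1] -/
theorem spinNumber_commutator_fermionEmbed_eq {Λ₁ : Finset (Site d)} (h1 : Λ ⊆ Λ₁) (h8 : Λ₁ ⊆ Λ') (σ : Fin 2)
    (B : FermionOp Λ) :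
    (∑ p : PolySite Λ', numberOp p σ : FermionOp Λ') * fermionEmbed (PolySite.incl (h1.trans h8)) B -
        fermionEmbed (PolySite.incl (h1.trans h8)) B * (∑ p : PolySite Λ', numberOp p σ : FermionOp Λ') =
      fermionEmbed (PolySite.incl h8)
        ((∑ p : PolySite Λ₁, numberOp p σ : FermionOp Λ₁) * fermionEmbed (PolySite.incl h1) B -
          fermionEmbed (PolySite.incl h1) B * (∑ p : PolySite Λ₁, numberOp p σ : FermionOp Λ₁)) := by
  have hB : fermionEmbed (PolySite.incl (h1.trans h8)) B =
      fermionEmbed (PolySite.incl h8) (fermionEmbed (PolySite.incl h1) B) := by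
    rw [fermionEmbed_fermionEmbed, PolySite.incl_trans]
  have hrest := commute_outsideSpinNumber_fermionEmbed h8 σ (fermionEmbed (PolySite.incl h1) B)
  rw [← hB] at hrest
  rw [spinNumber_eq_fermionEmbed_add_sum h8 σ, Matrix.add_mul, Matrix.mul_add, hrest.eq, add_sub_add_right_eq_sub, hB,
    ← map_mul, ← map_mul, ← map_sub]

/-- **Support growth for the spin imbalance**: `M_{Λ'} ΓB − ΓB M_{Λ'} = Γ_{Λ₁⊆Λ'}(M_{Λ₁} ΓB − ΓB M_{Λ₁})`.
[cite: BratteliRobinsonII1997, §6.2.1] -/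
theorem spinImbalance_commutator_fermionEmbed_eq {Λ₁ : Finset (Site d)} (h1 : Λ ⊆ Λ₁) (h8 : Λ₁ ⊆ Λ')
    (B : FermionOp Λ) :
    (spinImbalance : FermionOp Λ') * fermionEmbed (PolySite.incl (h1.trans h8)) B -
        fermionEmbed (PolySite.incl (h1.trans h8)) B * (spinImbalance : FermionOp Λ') =
      fermionEmbed (PolySite.incl h8)
        ((spinImbalance : FermionOp Λ₁) * fermionEmbed (PolySite.incl h1) B -
          fermionEmbed (PolySite.incl h1) B * (spinImbalance : FermionOp Λ₁)) := by
  rw [spinImbalance_eq_spinNumber_sub_spinNumber, spinImbalance_eq_spinNumber_sub_spinNumber, Matrix.sub_mul,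
    Matrix.mul_sub, sub_sub_sub_comm, spinNumber_commutator_fermionEmbed_eq h1 h8 0 B,
    spinNumber_commutator_fermionEmbed_eq h1 h8 1 B, ← map_sub, Matrix.sub_mul, Matrix.mul_sub, sub_sub_sub_comm]

end Region

section RegionTT

variable (t t' U μ hz : ℝ)

set_option maxHeartbeats 400000 in
/-- **Support growth of the commutator with the local grand-canonical Hamiltonian**: for `Λ ⊆ Λ'` with
`thicken Λ 1 ⊆ Λ'` and `B ∈ 𝔄_Λ`,
`K_{Λ'} Γ_{Λ⊆Λ'}B − Γ_{Λ⊆Λ'}B K_{Λ'} = Γ_{Λ₁⊆Λ'}(K_{Λ₁} Γ_{Λ⊆Λ₁}B − Γ_{Λ⊆Λ₁}B K_{Λ₁})`, `Λ₁ = thicken Λ 1`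
(`t–t'` part: `hubbardTTPrime_localHamiltonian_commutator_fermionEmbed_eq`; charges: on-site).
[cite: BratteliRobinsonII1997, Thm. 6.2.4] -/
theorem gcLocalHamiltonianTT'_commutator_fermionEmbed_eq {Λ Λ' : Finset (Site 2)} (hΛ : Λ ⊆ Λ')
    (h8 : thicken Λ 1 ⊆ Λ') (B : FermionOp Λ) :
    gcLocalHamiltonianTT' Λ' t t' U μ hz * fermionEmbed (PolySite.incl hΛ) B -
        fermionEmbed (PolySite.incl hΛ) B * gcLocalHamiltonianTT' Λ' t t' U μ hz =
      fermionEmbed (PolySite.incl h8)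
        (gcLocalHamiltonianTT' (thicken Λ 1) t t' U μ hz * fermionEmbed (PolySite.incl (subset_thicken Λ 1)) B -
          fermionEmbed (PolySite.incl (subset_thicken Λ 1)) B * gcLocalHamiltonianTT' (thicken Λ 1) t t' U μ hz) := by
  have hH := hubbardTTPrime_localHamiltonian_commutator_fermionEmbed_eq t t' U hΛ h8 B
  have hN := totalNumber_commutator_fermionEmbed_eq (subset_thicken Λ 1) h8 B
  have hM := spinImbalance_commutator_fermionEmbed_eq (subset_thicken Λ 1) h8 B
  have hincl : fermionEmbed (PolySite.incl ((subset_thicken Λ 1).trans h8)) B = fermionEmbed (PolySite.incl hΛ) B := rfl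
  rw [hincl] at hN hM
  rw [gcLocalHamiltonianTT', gcLocalHamiltonianTT', Matrix.sub_mul, Matrix.sub_mul, Matrix.mul_sub, Matrix.mul_sub,
    Matrix.smul_mul, Matrix.smul_mul, Matrix.mul_smul, Matrix.mul_smul,
    show ∀ a b c a' b' c' : FermionOp Λ', a - b - c - (a' - b' - c') = (a - a') - (b - b') - (c - c') from
      fun _ _ _ _ _ _ => by abel,
    ← smul_sub, ← smul_sub, hH, hN, hM, ← fermionEmbed_smul, ← fermionEmbed_smul, ← fermionEmbed_sub,
    ← fermionEmbed_sub, Matrix.sub_mul, Matrix.sub_mul, Matrix.mul_sub, Matrix.mul_sub, Matrix.smul_mul,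
    Matrix.smul_mul, Matrix.mul_smul, Matrix.mul_smul, smul_sub, smul_sub]
  congr 1
  abel

end RegionTT

/-! ### §2 Iterated locality on the torus: `Γ(ad_{K_{Λ'}}^k Ã) = ad_{K_L}^k (ΓÃ)` -/

section IteratedLocality

/-- `ad^{k+1} = ad^k ∘ ad`. [folklore] -/
private theorem adPow_succ'' {m : Type*} [Fintype m] (H a : Matrix m m ℂ) (k : ℕ) :
    adPow H (k + 1) a = adPow H k (H * a - a * H) := by
  induction k with
  | zero => simp
  | succ k ih => rw [adPow_succ, ih, ← adPow_succ]

/-- The iterated neighbourhoods increase. [folklore] -/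
private theorem thicken_iterate_mono'' {d : ℕ} (Λ : Finset (Site d)) (R : ℝ) {k n : ℕ} (h : k ≤ n) :
    (fun S => thicken S R)^[k] Λ ⊆ (fun S => thicken S R)^[n] Λ := by
  induction n, h using Nat.le_induction with
  | base => exact subset_rfl
  | succ n _ ih =>
    refine ih.trans ?_
    rw [Function.iterate_succ_apply']
    exact subset_thicken _ R

variable (L : ℕ) [NeZero L] (t t' U μ hz : ℝ)

/-- **Iterated locality of the commutator with the grand-canonical torus Hamiltonian**: for a window `Λ'`
(`x ↦ x mod L` injective on `thicken Λ' 1`), `Λ ⊆ Λ'` with `((·)₁)^k Λ ⊆ Λ'`, and `A ∈ 𝔄_Λ`: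
`Γ(ad_{K_{Λ'}}^k Ã) = ad_{K_L}^k (ΓÃ)`, `Ã = Γ_{Λ⊆Λ'}A`, `K_{Λ'} = gcLocalHamiltonianTT' Λ' t t' U μ h`.
[cite: BratteliRobinsonII1997, Thm. 6.2.4] -/
theorem fermionEmbed_toTorusEmb_adPow_gcLocalHamiltonianTT' {Λ' : Finset (Site 2)}
    (hInj : Set.InjOn (Torus.proj (d := 2) L) ↑(thicken Λ' 1)) (k : ℕ) :
    ∀ {Λ : Finset (Site 2)} (hΛ : Λ ⊆ Λ') (_ : (fun S => thicken S 1)^[k] Λ ⊆ Λ') (A : FermionOp Λ),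
      fermionEmbed (PolySite.toTorusEmb L (hInj.mono (by exact_mod_cast subset_thicken Λ' 1)))
          (adPow (gcLocalHamiltonianTT' Λ' t t' U μ hz) k (fermionEmbed (PolySite.incl hΛ) A)) =
        adPow (gcTorusHamiltonianTT' L t t' U μ hz) k
          (fermionEmbed (PolySite.toTorusEmb L (hInj.mono (by exact_mod_cast subset_thicken Λ' 1)))
            (fermionEmbed (PolySite.incl hΛ) A)) := by
  induction k with
  | zero =>
    intro Λ hΛ _ A
    rfl
  | succ k ih =>
    intro Λ hΛ hk A
    have h1 : thicken Λ 1 ⊆ Λ' :=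
      (thicken_iterate_mono'' Λ 1 (Nat.succ_le_succ (Nat.zero_le k))).trans hk
    rw [adPow_succ'', adPow_succ'', gcTorusHamiltonianTT'_commutator_fermionEmbed L t t' U μ hz hΛ h1 hInj A,
      gcLocalHamiltonianTT'_commutator_fermionEmbed_eq t t' U μ hz hΛ h1 A]
    exact ih h1 hk _

end IteratedLocality

/-! ### §3 Finite volume: the KMS-moment rows in the translated grand-canonical eigen-mixtures, every word -/

section FiniteVolume

variable (L : ℕ) [NeZero L] (β t t' U μ hz : ℝ)

/-- **KMS-moment rows for the translated grand-canonical Gibbs mixtures, EVERY torus word `a`**: for a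
translation `v`, every real `β` and coefficients with `Σ_{k≤K}(pₖ + qₖe^{-βx})x^k ≥ 0` on `ℝ`:
`0 ≤ Σ_{k≤K} ( pₖ Σ_i p_{L,i} Re⟨U_vψ_{L,i}, aᴴ(ad_{K_L}^k a) U_vψ_{L,i}⟩ + qₖ Σ_i p_{L,i} Re⟨U_vψ_{L,i}, (ad_{K_L}^k a)aᴴ U_vψ_{L,i}⟩ )`.
[cite: ItoiEtAl2023, §3] -/
theorem sum_range_kmsMoment_gcGibbs_fockTranslate_nonneg (v : TorusSite 2 L)
    (a : Matrix (Finset (Orb (FermionTorus 2 L))) (Finset (Orb (FermionTorus 2 L))) ℂ) (K : ℕ) (cp cq : ℕ → ℝ)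
    (hP : ∀ x : ℝ, 0 ≤ ∑ k ∈ Finset.range (K + 1), (cp k + cq k * Real.exp (-(β * x))) * x ^ k) :
    0 ≤ ∑ k ∈ Finset.range (K + 1),
      (cp k * ∑ i, gcGibbsWeightTT' β t t' U μ hz L i *
          (star ((fockTranslate v).val *ᵥ gcGibbsVectorTT' t t' U μ hz L i) ⬝ᵥ
            ((aᴴ * adPow (gcTorusHamiltonianTT' L t t' U μ hz) k a) *ᵥ
              ((fockTranslate v).val *ᵥ gcGibbsVectorTT' t t' U μ hz L i))).re +
        cq k * ∑ i, gcGibbsWeightTT' β t t' U μ hz L i *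
          (star ((fockTranslate v).val *ᵥ gcGibbsVectorTT' t t' U μ hz L i) ⬝ᵥ
            ((adPow (gcTorusHamiltonianTT' L t t' U μ hz) k a * aᴴ) *ᵥ
              ((fockTranslate v).val *ᵥ gcGibbsVectorTT' t t' U μ hz L i))).re) := by
  set H := gcTorusHamiltonianTT' L t t' U μ hz with hHdef
  have hA : H.IsHermitian := gcTorusHamiltonianTT'_isHermitian L t t' U μ hz
  have hvac : ∀ (X : Matrix (Finset (Orb (FermionTorus 2 L))) (Finset (Orb (FermionTorus 2 L))) ℂ)
      (i j : Finset (Orb (FermionTorus 2 L))), ¬ (fun _ => True) i → (fun _ => True) j → X i j = 0 :=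
    fun _ _ _ hi _ => (hi trivial).elim
  have key := sum_range_kmsMoment_sectorMixture_mulVec_nonneg (fun _ => True) hA (hvac H)
    (fockTranslate_val_conjTranspose_mul_val_mul L v) (fockTranslate_val_mul_val_conjTranspose_mul L v)
    (fockTranslate_commute_gcTorusHamiltonianTT' L t t' U μ hz v) (hvac _) (hvac _) (hvac a) (hvac aᴴ) β K cp cq hP
  set e := sourcedGibbsIndex L with he
  have hw : ∀ i, gcGibbsWeightTT' β t t' U μ hz L i = canonicalWeight β (sectorEigenvalue (fun _ => True) H hA) (e i) := by
    intro i
    rw [gcGibbsWeightTT', show gcGibbsEnergyTT' t t' U μ hz L = sectorEigenvalue (fun _ => True) H hA ∘ e from rfl,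
      canonicalWeight_comp_equiv']
  have hv' : ∀ i, gcGibbsVectorTT' t t' U μ hz L i = sectorEigenvector (fun _ => True) H hA (e i) := fun i => rfl
  refine key.trans_eq (Finset.sum_congr rfl fun k _ => ?_)
  simp_rw [hw, hv']
  rw [← Equiv.sum_comp e (fun s => canonicalWeight β (sectorEigenvalue (fun _ => True) H hA) s *
      (star ((fockTranslate v).val *ᵥ sectorEigenvector (fun _ => True) H hA s) ⬝ᵥ
        ((aᴴ * adPow H k a) *ᵥ ((fockTranslate v).val *ᵥ sectorEigenvector (fun _ => True) H hA s))).re),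
    ← Equiv.sum_comp e (fun s => canonicalWeight β (sectorEigenvalue (fun _ => True) H hA) s *
      (star ((fockTranslate v).val *ᵥ sectorEigenvector (fun _ => True) H hA s) ⬝ᵥ
        ((adPow H k a * aᴴ) *ᵥ ((fockTranslate v).val *ᵥ sectorEigenvector (fun _ => True) H hA s))).re)]

end FiniteVolume

/-! ### §4 Translation averages of the embedded KMS-moment rows -/

section TorusAverage

variable (L : ℕ) [NeZero L] (β t t' U μ hz : ℝ)

/-- **The KMS-moment rows of ANY local word, averaged over the torus translations, in the grand-canonical Gibbs
mixture**: for a window `Λ'` (`x ↦ x mod L` injective on `thicken Λ' 1`), `Λ ⊆ Λ'` with `((·)₁)^K Λ ⊆ Λ'`, every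
`A ∈ 𝔄_Λ` (`Ã = Γ_{Λ⊆Λ'}A`), `K_{Λ'} = gcLocalHamiltonianTT' Λ' t t' U μ h`, every real `β` and coefficients
with `Σ_{k≤K}(pₖ + qₖe^{-βx})x^k ≥ 0`:
`0 ≤ Σ_{k≤K} ( pₖ Re Σ_i p_{L,i} avg(Ãᴴ ad^k Ã) + qₖ Re Σ_i p_{L,i} avg((ad^k Ã)Ãᴴ) )`. [cite: ItoiEtAl2023, §3] -/
theorem re_sum_range_kmsMoment_torusAvgExpectAt_nonneg_gc {Λ Λ' : Finset (Site 2)} (hΛ : Λ ⊆ Λ')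
    {K : ℕ} (hK : (fun S => thicken S 1)^[K] Λ ⊆ Λ')
    (hInj : Set.InjOn (Torus.proj (d := 2) L) ↑(thicken Λ' 1)) (A : FermionOp Λ) (cp cq : ℕ → ℝ)
    (hP : ∀ x : ℝ, 0 ≤ ∑ k ∈ Finset.range (K + 1), (cp k + cq k * Real.exp (-(β * x))) * x ^ k) :
    0 ≤ ∑ k ∈ Finset.range (K + 1),
      (cp k * (∑ i, (gcGibbsWeightTT' β t t' U μ hz L i : ℂ) *
          torusAvgExpectAt L Λ'
            ((fermionEmbed (PolySite.incl hΛ) A)ᴴ *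
              adPow (gcLocalHamiltonianTT' Λ' t t' U μ hz) k (fermionEmbed (PolySite.incl hΛ) A))
            (gcGibbsVectorTT' t t' U μ hz L i)).re +
        cq k * (∑ i, (gcGibbsWeightTT' β t t' U μ hz L i : ℂ) *
          torusAvgExpectAt L Λ'
            (adPow (gcLocalHamiltonianTT' Λ' t t' U μ hz) k (fermionEmbed (PolySite.incl hΛ) A) *
              (fermionEmbed (PolySite.incl hΛ) A)ᴴ)
            (gcGibbsVectorTT' t t' U μ hz L i)).re) := by
  have h₁ : Set.InjOn (Torus.proj (d := 2) L) ↑Λ' := hInj.mono (by exact_mod_cast subset_thicken Λ' 1)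
  set H := gcTorusHamiltonianTT' L t t' U μ hz with hHdef
  set B := fermionEmbed (PolySite.toTorusEmb L h₁) (fermionEmbed (PolySite.incl hΛ) A) with hBdef
  -- iterated locality: the pulled-back `ad^k` words are the torus `ad^k` words for `k ≤ K`
  have had : ∀ k ∈ Finset.range (K + 1), fermionEmbed (PolySite.toTorusEmb L h₁)
      (adPow (gcLocalHamiltonianTT' Λ' t t' U μ hz) k (fermionEmbed (PolySite.incl hΛ) A)) = adPow H k B := by
    intro k hk
    rw [fermionEmbed_toTorusEmb_adPow_gcLocalHamiltonianTT' L t t' U μ hz hInj k hΛ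
      ((thicken_iterate_mono'' Λ 1 (Nat.lt_succ_iff.1 (Finset.mem_range.1 hk))).trans hK) A]
  have hΓ1 : ∀ k ∈ Finset.range (K + 1), fermionEmbed (PolySite.toTorusEmb L h₁)
      ((fermionEmbed (PolySite.incl hΛ) A)ᴴ *
        adPow (gcLocalHamiltonianTT' Λ' t t' U μ hz) k (fermionEmbed (PolySite.incl hΛ) A)) = Bᴴ * adPow H k B := by
    intro k hk
    rw [fermionEmbed_mul, fermionEmbed_conjTranspose, had k hk]
  have hΓ2 : ∀ k ∈ Finset.range (K + 1), fermionEmbed (PolySite.toTorusEmb L h₁)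
      (adPow (gcLocalHamiltonianTT' Λ' t t' U μ hz) k (fermionEmbed (PolySite.incl hΛ) A) *
        (fermionEmbed (PolySite.incl hΛ) A)ᴴ) = adPow H k B * Bᴴ := by
    intro k hk
    rw [fermionEmbed_mul, fermionEmbed_conjTranspose, had k hk]
  -- each translate satisfies the rows
  have hv : ∀ v : TorusSite 2 L, 0 ≤ ∑ k ∈ Finset.range (K + 1),
      (cp k * ∑ i, gcGibbsWeightTT' β t t' U μ hz L i *
          (expect (Bᴴ * adPow H k B) ((fockTranslate v).val *ᵥ gcGibbsVectorTT' t t' U μ hz L i)).re +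
        cq k * ∑ i, gcGibbsWeightTT' β t t' U μ hz L i *
          (expect (adPow H k B * Bᴴ) ((fockTranslate v).val *ᵥ gcGibbsVectorTT' t t' U μ hz L i)).re) := fun v =>
    sum_range_kmsMoment_gcGibbs_fockTranslate_nonneg L β t t' U μ hz v B K cp cq hP
  -- bookkeeping: real part of the weighted translation average
  have hcast : ((Fintype.card (TorusSite 2 L) : ℂ))⁻¹ =
      (((Fintype.card (TorusSite 2 L) : ℝ)⁻¹ : ℝ) : ℂ) := by
    push_cast; rfl
  have hre : ∀ X : Matrix (Finset (Orb (FermionTorus 2 L))) (Finset (Orb (FermionTorus 2 L))) ℂ,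
      (∑ i, (gcGibbsWeightTT' β t t' U μ hz L i : ℂ) *
        (((Fintype.card (TorusSite 2 L) : ℂ))⁻¹ *
          ∑ v : TorusSite 2 L, expect X ((fockTranslate v).val *ᵥ gcGibbsVectorTT' t t' U μ hz L i))).re =
      (Fintype.card (TorusSite 2 L) : ℝ)⁻¹ * ∑ v : TorusSite 2 L, ∑ i, gcGibbsWeightTT' β t t' U μ hz L i *
        (expect X ((fockTranslate v).val *ᵥ gcGibbsVectorTT' t t' U μ hz L i)).re := by
    intro X
    rw [Complex.re_sum]
    simp_rw [hcast, ← mul_assoc, ← Complex.ofReal_mul, Complex.re_ofReal_mul, Complex.re_sum,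
      Finset.mul_sum]
    rw [Finset.sum_comm]
    exact Finset.sum_congr rfl fun v _ => Finset.sum_congr rfl fun i _ => by ring
  calc (0 : ℝ) ≤ (Fintype.card (TorusSite 2 L) : ℝ)⁻¹ * ∑ v : TorusSite 2 L, ∑ k ∈ Finset.range (K + 1),
      (cp k * ∑ i, gcGibbsWeightTT' β t t' U μ hz L i *
          (expect (Bᴴ * adPow H k B) ((fockTranslate v).val *ᵥ gcGibbsVectorTT' t t' U μ hz L i)).re +
        cq k * ∑ i, gcGibbsWeightTT' β t t' U μ hz L i *
          (expect (adPow H k B * Bᴴ) ((fockTranslate v).val *ᵥ gcGibbsVectorTT' t t' U μ hz L i)).re) :=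
      mul_nonneg (inv_nonneg.2 (Nat.cast_nonneg _)) (Finset.sum_nonneg fun v _ => hv v)
    _ = _ := by
      rw [Finset.sum_comm, Finset.mul_sum]
      refine Finset.sum_congr rfl fun k hk => ?_
      simp_rw [torusAvgExpectAt_of_injOn L h₁]
      rw [hΓ1 k hk, hΓ2 k hk, hre, hre, Finset.sum_add_distrib, ← Finset.mul_sum, ← Finset.mul_sum]
      ring

end TorusAverage

/-! ### §5 The KMS-moment rows of thermal grand-canonical states, every local word -/

namespace InfVolFermionState

/-- **KMS-moment rows of thermal grand-canonical states, for EVERY local word.** Let `ω` be a torus limit of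
the grand-canonical Gibbs states of `K_{Ls j}(t,t',U,μ,h)` at (any real) inverse temperature `β` along
`Ls → ∞`. Then for every region `Λ`, every window `Λ' ⊇ Λ` with `(fun S => thicken S 1)^[K] Λ ⊆ Λ'`, EVERY
`A ∈ 𝔄_Λ` — charged words included — (`Ã = Γ_{Λ⊆Λ'}A`, `K = K_{Λ'} = H^{tt'}_{Λ'} − μN_{Λ'} − hM_{Λ'}`) and all
`p q : ℕ → ℝ` with `Σ_{k≤K}(pₖ + qₖe^{-βx})x^k ≥ 0` on `ℝ`:

  `0 ≤ Σ_{k≤K} ( pₖ Re ω_{Λ'}(Ãᴴ ad_K^k Ã) + qₖ Re ω_{Λ'}((ad_K^k Ã)Ãᴴ) )`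

— positivity of the exponential polynomial against the spectral measure of `Ã` in a `β`-KMS state of the
grand-canonical dynamics (Itoi–Ishimori–Sato–Sakamoto §3); the `K = 1` members with `P` a tangent line of the EEB
function are the rows of `HubbardTTPrimeGrandCanonicalThermalStatesKMSRows`. [cite: ItoiEtAl2023, §3] -/
theorem IsTorusLimitOfMixture.sum_range_kmsMoment_nonneg_of_gcGibbs
    (t t' U μ hz : ℝ) {β : ℝ} {ω : InfVolFermionState 2} {Ls : ℕ → ℕ}
    (h : ω.IsTorusLimitOfMixture sourcedGibbsCount (gcGibbsWeightTT' β t t' U μ hz)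
      (gcGibbsVectorTT' t t' U μ hz) Ls)
    (hLs : Tendsto Ls atTop atTop) {Λ Λ' : Finset (Site 2)} (hΛ : Λ ⊆ Λ') {K : ℕ}
    (hK : (fun S => thicken S 1)^[K] Λ ⊆ Λ') (A : FermionOp Λ) (cp cq : ℕ → ℝ)
    (hP : ∀ x : ℝ, 0 ≤ ∑ k ∈ Finset.range (K + 1), (cp k + cq k * Real.exp (-(β * x))) * x ^ k) :
    0 ≤ ∑ k ∈ Finset.range (K + 1),
      (cp k * (ω.expect Λ'
          ((fermionEmbed (PolySite.incl hΛ) A)ᴴ *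
            adPow (gcLocalHamiltonianTT' Λ' t t' U μ hz) k (fermionEmbed (PolySite.incl hΛ) A))).re +
        cq k * (ω.expect Λ'
          (adPow (gcLocalHamiltonianTT' Λ' t t' U μ hz) k (fermionEmbed (PolySite.incl hΛ) A) *
            (fermionEmbed (PolySite.incl hΛ) A)ᴴ)).re) := by
  have hlim : Tendsto (fun j => ∑ k ∈ Finset.range (K + 1),
      (cp k * (∑ i, (gcGibbsWeightTT' β t t' U μ hz (Ls j) i : ℂ) *
          torusAvgExpect (Ls j) Λ'
            ((fermionEmbed (PolySite.incl hΛ) A)ᴴ *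
              adPow (gcLocalHamiltonianTT' Λ' t t' U μ hz) k (fermionEmbed (PolySite.incl hΛ) A))
            (gcGibbsVectorTT' t t' U μ hz (Ls j) i)).re +
        cq k * (∑ i, (gcGibbsWeightTT' β t t' U μ hz (Ls j) i : ℂ) *
          torusAvgExpect (Ls j) Λ'
            (adPow (gcLocalHamiltonianTT' Λ' t t' U μ hz) k (fermionEmbed (PolySite.incl hΛ) A) *
              (fermionEmbed (PolySite.incl hΛ) A)ᴴ)
            (gcGibbsVectorTT' t t' U μ hz (Ls j) i)).re)) atTop
      (𝓝 (∑ k ∈ Finset.range (K + 1),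
        (cp k * (ω.expect Λ'
            ((fermionEmbed (PolySite.incl hΛ) A)ᴴ *
              adPow (gcLocalHamiltonianTT' Λ' t t' U μ hz) k (fermionEmbed (PolySite.incl hΛ) A))).re +
          cq k * (ω.expect Λ'
            (adPow (gcLocalHamiltonianTT' Λ' t t' U μ hz) k (fermionEmbed (PolySite.incl hΛ) A) *
              (fermionEmbed (PolySite.incl hΛ) A)ᴴ)).re))) :=
    tendsto_finsetSum _ fun k _ =>
      (((Complex.continuous_re.tendsto _).comp (h Λ' _)).const_mul (cp k)).add
        (((Complex.continuous_re.tendsto _).comp (h Λ' _)).const_mul (cq k))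
  refine ge_of_tendsto hlim ?_
  filter_upwards [eventually_injOn_proj_of_tendsto (thicken Λ' 1) hLs, hLs.eventually_ge_atTop 1]
    with j hInj hj
  haveI : NeZero (Ls j) := ⟨by omega⟩
  simp_rw [torusAvgExpect_eq]
  exact re_sum_range_kmsMoment_torusAvgExpectAt_nonneg_gc (Ls j) β t t' U μ hz hΛ hK hInj A cp cq hP

end InfVolFermionState

end Literature.MathematicalPhysics.QuantumLattice

end
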